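import Summits.KontsevichZagierPeriods.KontsevichZagierPeriods.Theses.IsogenyCertificates
import Summits.KontsevichZagierPeriods.KontsevichZagierPeriods.Theorems.XMapPeriodTransfer.Negative.ValueEqLoadBearing
import Summits.KontsevichZagierPeriods.KontsevichZagierPeriods.Theorems.IsogenyCertificatesXMapPeriodTransferCellsBasic
import Summits.KontsevichZagierPeriods.KontsevichZagierPeriods.Theorems.IsogenyCertificatesXMapPeriodTransferStubCellMonotone
import Summits.KontsevichZagierPeriods.KontsevichZagierPeriods.Theorems.IsogenyCertificatesXMapPeriodTransferStubCellEnds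
import Summits.KontsevichZagierPeriods.KontsevichZagierPeriods.Theorems.IsogenyCertificatesXMapPeriodTransferStubIntervalImage
import Summits.KontsevichZagierPeriods.KontsevichZagierPeriods.Theorems.IsogenyCertificatesXMapPeriodTransferStubCubicComponents
import Summits.KontsevichZagierPeriods.KontsevichZagierPeriods.Theorems.IsogenyCertificatesXMapPeriodTransferStubDupDatum

/-!
# `XMapPeriodTransfer` (stmt-KontsevichZagierPeriods-10665) — line `saturated-sign-cells`: cell images

Proof of the crux `IsogenyCertificates.XMapPeriodTransfer` (route IsogenyCertificates, rank 3) by the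
line `saturated-sign-cells` (Cruxes/XMapPeriodTransfer/PICKED.md, Lines/saturated_sign_cells.lean):
WLOG `f, g` coprime (`XMapPeriodTransferDatum.iff_coprime`); the cells of `{P > 0} ∖ {W = 0}` are
mapped by `R = f/g` strictly monotonically (`stub_cellMonotone`) onto WHOLE components of `{P' > 0}`
(`stub_cellEnds`, `stub_intervalImage`, `stub_cubicComponents`); one rule-(2) move per cell
(`stub_cellMove`) and finite domain/integrand additivity give the census
`[K, a/√P] ≡ [U', (m_U a/|c|)/√P'] + [egg', (m_E a/|c|)/√P']` (`stub_cellCensus`); the duplication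
datum on the target (`stub_dupDatum`, all cells onto `U'` by the 2-descent square identity) pushes
both `[r]` and `[r']` onto `[U', γ/√P']`, `[U', γ'/√P']` with rational `γ, γ'`; soundness,
`r.value = r'.value` (used exactly once, here) and `∫_{U'} dx/√P' > 0` give `γ = γ'`. No definitions
are introduced (the x-map, Wronskian, cell locus, unbounded component and egg are written out).
This file: the cell-image theorem `stub_cellImageComponent` assembled from the landed stubs, the
saturation of the two components, the duplication datum's cells (`dup_cell_image`), and the
representations `[D, s/√P]` with their values; the transfer itself is in
`Theorems/IsogenyCertificatesXMapPeriodTransfer.lean`.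

References: M. Kontsevich, D. Zagier, *Periods* (2001), §1.2; J. H. Silverman, *The Arithmetic of
Elliptic Curves* (2009), III.4–III.6; J. W. S. Cassels, *Lectures on Elliptic Curves* (1991), §15;
S. Basu, R. Pollack, M.-F. Roy, *Algorithms in Real Algebraic Geometry* (2006), Thm. 5.22.
-/

noncomputable section

open Set Filter MeasureTheory Polynomial Topology
open Literature.NumberTheory.Transcendental
open Literature.ModelTheory.ExponentialFields (IsSemialgebraic)
open Summit.KontsevichZagierPeriods.KontsevichZagierPeriods.Theses.IsogenyCertificates (XMapPeriodTransfer)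

namespace Summit.KontsevichZagierPeriods.IsogenyCertificates.XMapPeriodTransferCells

/-! ### Every cell is mapped injectively onto a whole component of `{P' > 0}` -/

/-- **Registered stub `stub_cellImageComponent`** (assembled here from `stub_cellMonotone`,
`stub_cellEnds`, `stub_intervalImage`, `stub_cubicComponents`): the image of every cell of a COPRIME
datum is the unbounded component `U'` of `{P' > 0}`, or its egg `E'`, the latter lying strictly below
a root of `P'`; and the x-map is injective on the cell. [folklore] -/
theorem stub_cellImageComponent : ∀ (A B A' B' : ℤ) (f g : ℚ[X]) (c : ℚ),
    4 * A' ^ 3 + 27 * B' ^ 2 ≠ 0 →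
    derivative f * g - f * derivative g ≠ 0 →
    C (c ^ 2) * g * (f ^ 3 + C (A' : ℚ) * f * g ^ 2 + C (B' : ℚ) * g ^ 3) =
      (X ^ 3 + C (A : ℚ) * X + C (B : ℚ)) * (derivative f * g - f * derivative g) ^ 2 →
    IsCoprime f g →
    ∀ (R W : ℝ → ℝ) (L : Set ℝ), R = (fun y => aeval y f / aeval y g) →
      W = (fun y => aeval y (derivative f * g - f * derivative g)) →
      L = {y : ℝ | 0 < y ^ 3 + (A : ℝ) * y + (B : ℝ) ∧ W y ≠ 0} →
    ∀ (U' E' : Set ℝ), U' = connectedComponentIn {y : ℝ | 0 < y ^ 3 + (A' : ℝ) * y + (B' : ℝ)}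
        (1 + |(A' : ℝ)| + |(B' : ℝ)|) →
      E' = {y : ℝ | 0 < y ^ 3 + (A' : ℝ) * y + (B' : ℝ)} \ U' →
    ∀ x₀ ∈ L, InjOn R (connectedComponentIn L x₀) ∧
      (R '' connectedComponentIn L x₀ = U' ∨
        (R '' connectedComponentIn L x₀ = E' ∧
          ∃ v : ℝ, v ^ 3 + (A' : ℝ) * v + (B' : ℝ) = 0 ∧ ∀ y ∈ R '' connectedComponentIn L x₀, y < v)) := by
  intro A B A' B' f g c hΔ' hW hI hcop R W L hR hWd hL' U' E' hU' hE' x₀ hx₀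
  subst hU' hE'
  obtain ⟨hloc, hmono, p, hpx, hpW, hshape⟩ :=
    stub_cellMonotone A B A' B' f g c hW hI R W L hR hWd hL' x₀ hx₀
  obtain ⟨hends, hinf⟩ := stub_cellEnds A B A' B' f g c hW hI hcop R W hR hWd
  have hx₀C : x₀ ∈ connectedComponentIn L x₀ := mem_connectedComponentIn hx₀
  have hinj : InjOn R (connectedComponentIn L x₀) := by
    rcases hmono with h | h
    · exact h.injOn
    · exact h.injOn
  refine ⟨hinj, ?_⟩
  have hcont : ContinuousOn R (connectedComponentIn L x₀) := fun x hx =>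
    (hloc x hx).2.2.continuousAt.continuousWithinAt
  have hsub : R '' connectedComponentIn L x₀ ⊆ {y : ℝ | 0 < y ^ 3 + (A' : ℝ) * y + (B' : ℝ)} := by
    rintro _ ⟨x, hx, rfl⟩
    exact (hloc x hx).2.1
  have hCshape : connectedComponentIn L x₀ = Ioi p ∨
      ∃ q : ℝ, p < q ∧ connectedComponentIn L x₀ = Ioo p q := by
    rcases hshape with h | ⟨q, hxq, _, h⟩
    · exact Or.inl h
    · exact Or.inr ⟨q, hpx.trans hxq, h⟩
  -- one-sided limits from the punctured ones
  have mono_ne : ∀ {p : ℝ} {s : Set ℝ}, s ⊆ {p}ᶜ → 𝓝[s] p ≤ 𝓝[≠] p := fun h => nhdsWithin_mono _ h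
  have hleft : (∃ ℓ : ℝ, ℓ ^ 3 + (A' : ℝ) * ℓ + (B' : ℝ) = 0 ∧ Tendsto R (𝓝[>] p) (𝓝 ℓ)) ∨
      Tendsto (fun x => |R x|) (𝓝[>] p) atTop := by
    rcases hends p hpW with ⟨ℓ, hℓ, ht⟩ | ht
    · exact Or.inl ⟨ℓ, hℓ, ht.mono_left (mono_ne fun x hx => ne_of_gt hx)⟩
    · exact Or.inr (ht.mono_left (mono_ne fun x hx => ne_of_gt hx))
  -- the right end `q` of a bounded cell satisfies `P(q)·W(q) = 0`
  have hqW : ∀ q : ℝ, connectedComponentIn L x₀ = Ioo p q →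
      (q ^ 3 + (A : ℝ) * q + (B : ℝ)) * W q = 0 := by
    intro q hq
    have hx₀q : p < x₀ ∧ x₀ < q := by rw [hq] at hx₀C; exact hx₀C
    rcases hshape with h | ⟨q', hxq', hq'W, h⟩
    · exfalso
      have hmem : q + 1 ∈ Ioi p := by
        show p < q + 1
        linarith [hx₀q.1, hx₀q.2]
      rw [← h, hq] at hmem
      linarith [hmem.2]
    · have e1 : Ioo p q = Ioo p q' := hq.symm.trans h
      have h1 := (Set.Ioo_subset_Ioo_iff (hx₀q.1.trans hx₀q.2)).1 e1.le
      have h2 := (Set.Ioo_subset_Ioo_iff (hpx.trans hxq')).1 e1.ge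
      have hqq : q = q' := le_antisymm h1.2 h2.2
      rw [hqq]; exact hq'W
  have hright : ∀ q : ℝ, connectedComponentIn L x₀ = Ioo p q →
      (∃ ℓ : ℝ, ℓ ^ 3 + (A' : ℝ) * ℓ + (B' : ℝ) = 0 ∧ Tendsto R (𝓝[<] q) (𝓝 ℓ)) ∨
        Tendsto (fun x => |R x|) (𝓝[<] q) atTop := by
    intro q hq
    rcases hends q (hqW q hq) with ⟨ℓ, hℓ, ht⟩ | ht
    · exact Or.inl ⟨ℓ, hℓ, ht.mono_left (mono_ne fun x hx => ne_of_lt hx)⟩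
    · exact Or.inr (ht.mono_left (mono_ne fun x hx => ne_of_lt hx))
  have hinf' : connectedComponentIn L x₀ = Ioi p →
      (∃ ℓ : ℝ, ℓ ^ 3 + (A' : ℝ) * ℓ + (B' : ℝ) = 0 ∧ Tendsto R atTop (𝓝 ℓ)) ∨
        Tendsto (fun x => |R x|) atTop atTop := fun _ => hinf
  obtain ⟨u, hu, himg⟩ := stub_intervalImage A' B' R (connectedComponentIn L x₀)
    p hCshape hcont hmono hsub hleft hright hinf'
  obtain ⟨hK1, hK2⟩ := stub_cubicComponents A' B' hΔ' _ rfl u hu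
  rcases himg with h | ⟨v, hv, huv, h⟩
  · left
    rw [h]
    exact hK1 (h ▸ hsub)
  · right
    refine ⟨?_, v, hv, fun y hy => ?_⟩
    · rw [h]; exact hK2 v hv huv (h ▸ hsub)
    · rw [h] at hy; exact hy.2

/-- A cell lies in `{P > 0}`. -/
theorem cell_subset_pos (A B : ℤ) (f g : ℚ[X]) (x₀ : ℝ) :
    connectedComponentIn {y : ℝ | 0 < y ^ 3 + (A : ℝ) * y + (B : ℝ) ∧
      aeval y (derivative f * g - f * derivative g) ≠ 0} x₀ ⊆
      {y : ℝ | 0 < y ^ 3 + (A : ℝ) * y + (B : ℝ)} :=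
  (connectedComponentIn_subset _ _).trans fun _ h => h.1

/-- A cell meeting the unbounded component lies in it (saturation). -/
theorem cell_subset_unbounded (A B : ℤ) (f g : ℚ[X]) {x₀ : ℝ}
    (hx₀ : x₀ ∈ {y : ℝ | 0 < y ^ 3 + (A : ℝ) * y + (B : ℝ) ∧
      aeval y (derivative f * g - f * derivative g) ≠ 0})
    (hK : x₀ ∈ connectedComponentIn {y : ℝ | 0 < y ^ 3 + (A : ℝ) * y + (B : ℝ)} (1 + |(A : ℝ)| + |(B : ℝ)|)) :
    connectedComponentIn {y : ℝ | 0 < y ^ 3 + (A : ℝ) * y + (B : ℝ) ∧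
      aeval y (derivative f * g - f * derivative g) ≠ 0} x₀ ⊆
      connectedComponentIn {y : ℝ | 0 < y ^ 3 + (A : ℝ) * y + (B : ℝ)} (1 + |(A : ℝ)| + |(B : ℝ)|) := by
  have h1 := (isPreconnected_connectedComponentIn).subset_connectedComponentIn
      (mem_connectedComponentIn hx₀) (cell_subset_pos A B f g x₀)
  rw [connectedComponentIn_eq hK]
  exact h1

/-- A cell meeting the egg lies in it (saturation). -/
theorem cell_subset_egg (A B : ℤ) (f g : ℚ[X]) {x₀ : ℝ}
    (hx₀ : x₀ ∈ {y : ℝ | 0 < y ^ 3 + (A : ℝ) * y + (B : ℝ) ∧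
      aeval y (derivative f * g - f * derivative g) ≠ 0})
    (hK : x₀ ∈ {y : ℝ | 0 < y ^ 3 + (A : ℝ) * y + (B : ℝ)} \
      connectedComponentIn {y : ℝ | 0 < y ^ 3 + (A : ℝ) * y + (B : ℝ)} (1 + |(A : ℝ)| + |(B : ℝ)|)) :
    connectedComponentIn {y : ℝ | 0 < y ^ 3 + (A : ℝ) * y + (B : ℝ) ∧
      aeval y (derivative f * g - f * derivative g) ≠ 0} x₀ ⊆
      {y : ℝ | 0 < y ^ 3 + (A : ℝ) * y + (B : ℝ)} \
        connectedComponentIn {y : ℝ | 0 < y ^ 3 + (A : ℝ) * y + (B : ℝ)} (1 + |(A : ℝ)| + |(B : ℝ)|) := by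
  have h1 := (isPreconnected_connectedComponentIn).subset_connectedComponentIn
      (mem_connectedComponentIn hx₀) (cell_subset_pos A B f g x₀)
  refine h1.trans fun z hz => ⟨connectedComponentIn_subset _ _ hz, fun hzU => hK.2 ?_⟩
  have e1 : connectedComponentIn {y : ℝ | 0 < y ^ 3 + (A : ℝ) * y + (B : ℝ)} x₀ =
      connectedComponentIn {y : ℝ | 0 < y ^ 3 + (A : ℝ) * y + (B : ℝ)} z := connectedComponentIn_eq hz
  rw [connectedComponentIn_eq hzU, ← e1]
  exact mem_connectedComponentIn hK.1

/-! ### The duplication datum on the target curve -/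

/-- Every cell of the duplication datum of a nonsingular curve is mapped injectively onto the
unbounded component. -/
theorem dup_cell_image (A B : ℤ) (hΔ : 4 * A ^ 3 + 27 * B ^ 2 ≠ 0) (f₂ g₂ : ℚ[X])
    (hf₂ : f₂ = X ^ 4 - C (2 * (A : ℚ)) * X ^ 2 - C (8 * (B : ℚ)) * X + C ((A : ℚ) ^ 2))
    (hg₂ : g₂ = C 4 * (X ^ 3 + C (A : ℚ) * X + C (B : ℚ))) {x₀ : ℝ}
    (hx₀ : x₀ ∈ {y : ℝ | 0 < y ^ 3 + (A : ℝ) * y + (B : ℝ) ∧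
      aeval y (derivative f₂ * g₂ - f₂ * derivative g₂) ≠ 0}) :
    InjOn (fun y => aeval y f₂ / aeval y g₂) (connectedComponentIn {y : ℝ | 0 < y ^ 3 + (A : ℝ) * y + (B : ℝ) ∧
      aeval y (derivative f₂ * g₂ - f₂ * derivative g₂) ≠ 0} x₀) ∧
    (fun y => aeval y f₂ / aeval y g₂) '' connectedComponentIn {y : ℝ | 0 < y ^ 3 + (A : ℝ) * y + (B : ℝ) ∧
        aeval y (derivative f₂ * g₂ - f₂ * derivative g₂) ≠ 0} x₀ =
      connectedComponentIn {y : ℝ | 0 < y ^ 3 + (A : ℝ) * y + (B : ℝ)} (1 + |(A : ℝ)| + |(B : ℝ)|) := by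
  obtain ⟨hW₂, hI₂, hcop₂, hge⟩ := stub_dupDatum A B f₂ g₂ hf₂ hg₂
  obtain ⟨hinj, himg⟩ := stub_cellImageComponent A B A B f₂ g₂ 2 hΔ hW₂ hI₂ (hcop₂ hΔ) _ _ _ rfl rfl rfl
    _ _ rfl rfl x₀ hx₀
  refine ⟨hinj, ?_⟩
  rcases himg with h | ⟨-, v, hv, hlt⟩
  · exact h
  · exfalso
    have h1 := hlt _ (mem_image_of_mem _ (mem_connectedComponentIn hx₀))
    exact absurd h1 (not_lt.2 (hge v x₀ hv hx₀.1))

/-! ### Representations with prescribed domain and integrand `s/√P` -/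

/-- Existence of the representation `[D, s/√P]` for a `ℚ`-semialgebraic `D ⊆ {P > 0}`, integrability
being inherited from that of `dx/√P` on `{P > 0}`. -/
theorem exists_rep (A B : ℤ) (s : ℚ) {D : Set (Fin 1 → ℝ)} (hD : IsSemialgebraic ℚ D)
    (hDS : D ⊆ {x : Fin 1 → ℝ | 0 < x 0 ^ 3 + (A : ℝ) * x 0 + (B : ℝ)})
    (hint : IntegrableOn (fun x : Fin 1 → ℝ => 1 / Real.sqrt (x 0 ^ 3 + (A : ℝ) * x 0 + (B : ℝ)))
      {x : Fin 1 → ℝ | 0 < x 0 ^ 3 + (A : ℝ) * x 0 + (B : ℝ)}) :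
    ∃ ρ : KZ.IntegralRep 1, ρ.domain = D ∧
      ρ.integrand = fun x => (s : ℝ) / Real.sqrt (x 0 ^ 3 + (A : ℝ) * x 0 + (B : ℝ)) := by
  have hmeas : MeasurableSet D :=
    Literature.ModelTheory.ExponentialFields.IsSemialgebraic.measurableSet_holds hD
  refine ⟨⟨D, fun x => (s : ℝ) / Real.sqrt (x 0 ^ 3 + (A : ℝ) * x 0 + (B : ℝ)), hD,
    (XMapPeriodTransferValue.isSemialgebraicFunOn_integrand A B s).mono hDS hD, ?_⟩, rfl, rfl⟩
  have h1 : IntegrableOn (fun x : Fin 1 → ℝ => (s : ℝ) * (1 / Real.sqrt (x 0 ^ 3 + (A : ℝ) * x 0 + (B : ℝ)))) D :=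
    (hint.mono_set hDS).const_mul (s : ℝ)
  refine h1.congr_fun (fun x _ => ?_) hmeas
  ring

/-- Value of a representation `[D, s/√P]`. -/
theorem value_rep {A B : ℤ} {s : ℚ} {D : Set (Fin 1 → ℝ)} (ρ : KZ.IntegralRep 1) (hd : ρ.domain = D)
    (he : EqOn ρ.integrand (fun x => (s : ℝ) / Real.sqrt (x 0 ^ 3 + (A : ℝ) * x 0 + (B : ℝ))) ρ.domain) :
    ρ.value = (s : ℝ) * ∫ x in D, 1 / Real.sqrt (x 0 ^ 3 + (A : ℝ) * x 0 + (B : ℝ)) := by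
  rw [KZ.IntegralRep.value, setIntegral_congr_fun (KZ.IntegralRep.measurableSet_domain_holds ρ) he, hd,
    ← integral_const_mul]
  congr 1; ext x; ring

/-- The unbounded-component period is positive. -/
theorem unbounded_period_pos (A B : ℤ)
    (hint : IntegrableOn (fun x : Fin 1 → ℝ => 1 / Real.sqrt (x 0 ^ 3 + (A : ℝ) * x 0 + (B : ℝ)))
      {x : Fin 1 → ℝ | 0 < x 0 ^ 3 + (A : ℝ) * x 0 + (B : ℝ)}) :
    0 < ∫ x in {x : Fin 1 → ℝ | x 0 ∈ connectedComponentIn {y : ℝ | 0 < y ^ 3 + (A : ℝ) * y + (B : ℝ)}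
      (1 + |(A : ℝ)| + |(B : ℝ)|)}, 1 / Real.sqrt (x 0 ^ 3 + (A : ℝ) * x 0 + (B : ℝ)) := by
  set U := connectedComponentIn {y : ℝ | 0 < y ^ 3 + (A : ℝ) * y + (B : ℝ)} (1 + |(A : ℝ)| + |(B : ℝ)|)
    with hU
  have hUopen : IsOpen U := (isOpen_lt continuous_const (by fun_prop)).connectedComponentIn
  have hopen : IsOpen {x : Fin 1 → ℝ | x 0 ∈ U} := hUopen.preimage (continuous_apply 0)
  have hmeas : MeasurableSet {x : Fin 1 → ℝ | x 0 ∈ U} := hopen.measurableSet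
  have hUS : U ⊆ {y : ℝ | 0 < y ^ 3 + (A : ℝ) * y + (B : ℝ)} := connectedComponentIn_subset _ _
  have hsubS : {x : Fin 1 → ℝ | x 0 ∈ U} ⊆ {x : Fin 1 → ℝ | 0 < x 0 ^ 3 + (A : ℝ) * x 0 + (B : ℝ)} :=
    fun x hx => hUS hx
  have hM : (1 + |(A : ℝ)| + |(B : ℝ)|) ∈ U :=
    mem_connectedComponentIn (stub_cellsBasic.1 A B _ le_rfl)
  rw [setIntegral_pos_iff_support_of_nonneg_ae ?_ (hint.mono_set hsubS)]
  · have hsub : {x : Fin 1 → ℝ | x 0 ∈ U} ⊆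
        Function.support (fun x : Fin 1 → ℝ => 1 / Real.sqrt (x 0 ^ 3 + (A : ℝ) * x 0 + (B : ℝ))) ∩
          {x : Fin 1 → ℝ | x 0 ∈ U} := by
      intro x hx
      refine ⟨?_, hx⟩
      simp only [Function.mem_support, ne_eq, one_div, inv_eq_zero]
      exact (Real.sqrt_pos.mpr (hUS hx)).ne'
    refine lt_of_lt_of_le ?_ (measure_mono hsub)
    exact hopen.measure_pos volume ⟨fun _ => 1 + |(A : ℝ)| + |(B : ℝ)|, hM⟩
  · filter_upwards [ae_restrict_mem hmeas] with x hx
    exact div_nonneg zero_le_one (Real.sqrt_nonneg _)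

end Summit.KontsevichZagierPeriods.IsogenyCertificates.XMapPeriodTransferCells

end
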